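import Literature.NumberTheory.GaloisCohomology.ShaRestrictedShapiroLayer
import Literature.NumberTheory.GaloisRepresentations.RestrictedCohomologyFunctoriality
import HarnessLib

/-!
# The Ш-condition transport intertwines the `Γ_K ⧸ N`-action on `Ind_N^{Γ_K} M` (right translations) with the
# conjugation action on the layer (NSW (1.6.5); Serre VII §5) — the (N-conj) dictionary of the layer Poitou–Tate pairing

Topic `NumberTheory/GaloisCohomology`; namespace `Literature.NumberTheory.GaloisCohomology.ShaLayer`.  THEOREMS ONLY
(no definition, no named fact, no `sorry`, no instance).  File 5 of the (M7) series, sequel of `ShaRestrictedShapiroLayer`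
(the transport `T = restrictedCohomologyEquiv`, the restricted Shapiro isomorphism `sh_S = layerShapiroEquiv`, the
layer action `layerConj`) and of `GaloisRepresentations/ContinuousShapiroOpenCoinducedMackeyVanishing`
(`shapiroCoindFinAddEquiv_rTransHom_one/_two`: `sh ∘ Hⁿ(R_{σN}) = conj_σ ∘ sh`, NSW (1.6.5)).

For `σ ∈ Γ_K`, the right translation `R_{σN}` of `Maps(Γ_K ⧸ N, M)` (`ρ.coindOpenRTrans N hN (σN)`, a `Γ_K`-endomorphism
of `Ind_N^{Γ_K} M`; it is how `Δ = Γ_K ⧸ N` acts on the induced module "sur le second facteur", Serre VII §5) induces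
`Hⁿ(G_S, R_{σN})` on `Hⁿ(G_S, Maps(Γ_K ⧸ N, M)^{N_S}) = restrictedCohomology (ρ.coindOpen N hN) S n` (the tree's
`ContinuousRep.invariantsHom` / `cohomologyMap`, the currency of the naturality clause (N) of
`poitouTate_shaRestricted_tateDual_natural_at` and of `PoitouTateShaRestrictedLayers` (N_V)).  This file proves

  `sh_S (T (Hⁿ(G_S, R_{σN}) c)) = layerConj (π σ) (sh_S (T c))`      (`n = 1, 2`; all `n` in the `R`-form),

i.e. under `shaRestrictedLayerEquiv` the `Δ`-action on `Шⁿ_S(K, Ind M)` IS the conjugation action of `Δ = G_S ⧸ N̄` on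
`Шⁿ_S(L, M) ≤ Hⁿ(N̄, M^{N_S})` — the dictionary that makes the layer Poitou–Tate map `Λ`-linear in the Iwasawa-cohomology
application (cell `bsd-print-cf2`, ROW 1 of the JLK descent).

* `mapsEquiv_rTransHom` (`mapsEquiv (R_{σN} φ) = R_{π(σ)N̄} (mapsEquiv φ)`), `invariantsEquiv_rTransHom`,
  `restrictedCohomologyEquiv_cohomologyMap_rTransHom` (`T ∘ Hⁿ(G_S, R_{σN}) = Hⁿ(R_{π(σ)N̄}) ∘ T`, every degree),
  **`layerShapiroEquiv_transport_rTransHom_one/_two`** (the displayed identity; on `Шⁿ_S` itself it is read through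
  `coe_shaRestrictedLayerEquiv_one/_two` and `DiscreteGaloisModule.map_mem_shaRestricted`).

HONEST FRAMING: bookkeeping; no arithmetic statement and no case of BSD is proved here.

## References
* J. Neukirch, A. Schmidt, K. Wingberg, *Cohomology of Number Fields*, 2nd ed. (2008), I §6 Prop. (1.6.5).
  [NeukirchSchmidtWingberg2008]
* J.-P. Serre, *Local Fields* (1979), VII §5 (Prop. 3 and the remark on `Hq(H, A)` as a `G/H`-module).
  [SerreLocalFields1979]
* J. S. Milne, *Arithmetic Duality Theorems*, 2nd ed. (2006), Ch. I §4 (p. 65, canonicity of the pairing). [MilneADT2006]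
-/

noncomputable section

open CategoryTheory Function NumberField Field IsDedekindDomain
open scoped NumberField Classical

namespace Literature.NumberTheory.GaloisCohomology

open Literature.NumberTheory.GaloisRepresentations
open Literature.NumberTheory.GaloisRepresentations.DiscreteGaloisModule (restrictedCohomology
  restrictedLocalization shaRestricted quotientInvariants)
open _root_.TopRep

namespace ShaLayer

variable {K : Type} [Field K] [NumberField K] (S : Set (HeightOneSpectrum (𝓞 K)))
variable {M : Type} [AddCommGroup M] [TopologicalSpace M] [DiscreteTopology M] (ρ : DiscreteGaloisModule K M)
variable (N : Subgroup (absoluteGaloisGroup K)) [N.Normal] (hN : IsOpen (N : Set (absoluteGaloisGroup K)))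
variable (hNS : ramificationSubgroup K S ≤ N) (hρ : ramificationSubgroup K S ≤ ContinuousRep.ker ρ)

/-- **`mapsEquiv` intertwines the right translations**: `mapsEquiv (R_{σN} φ) = R_{π(σ)N̄} (mapsEquiv φ)`
(`(R_c φ)(y) = φ(y c)`; `e : G_S ⧸ N̄ ≃* Γ_K ⧸ N` is multiplicative). [cite: SerreLocalFields1979, VII §5]
[cite: NeukirchSchmidtWingberg2008, I §6 Prop. (1.6.5)] -/
theorem mapsEquiv_rTransHom (σ : absoluteGaloisGroup K) (φ : absoluteGaloisGroup K ⧸ N → M) :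
    mapsEquiv S ρ N hN hNS hρ ((rTransHom ρ.toTopRep N (QuotientGroup.mk σ : absoluteGaloisGroup K ⧸ N)).hom φ) =
      (rTransHom (ρ.quotientInvariants (ramificationSubgroup K S)).toTopRep (N.map (toUnramifiedQuot K S))
        (QuotientGroup.mk (QuotientGroup.mk σ : GaloisGroupUnramifiedOutside K S) :
          GaloisGroupUnramifiedOutside K S ⧸ N.map (toUnramifiedQuot K S))).hom
        (mapsEquiv S ρ N hN hNS hρ φ) := by
  funext yb
  obtain ⟨x, rfl⟩ := QuotientGroup.mk_surjective yb
  obtain ⟨y, rfl⟩ := QuotientGroup.mk_surjective x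
  apply Subtype.ext
  rw [rTransHom_apply, ← QuotientGroup.mk_mul, ← QuotientGroup.mk_mul, mapsEquiv_apply_mk_mk, mapsEquiv_apply_mk_mk,
    rTransHom_apply, ← QuotientGroup.mk_mul]

/-- `invariantsEquiv` intertwines `Hom`-restricted right translations (`ContinuousRep.invariantsHom R_{σN}`) with
`R_{π(σ)N̄}`. [cite: SerreLocalFields1979, VII §5] -/
theorem invariantsEquiv_rTransHom [N.FiniteIndex] (σ : absoluteGaloisGroup K)
    (w : Representation.invariants ((ρ.coindOpen N hN).toRepresentation.comp (ramificationSubgroup K S).subtype)) :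
    invariantsEquiv S ρ N hN hNS hρ
        ((ContinuousRep.invariantsHom (N := ramificationSubgroup K S)
          (ρ.coindOpenRTrans N hN (QuotientGroup.mk σ : absoluteGaloisGroup K ⧸ N))).hom w) =
      (rTransHom (ρ.quotientInvariants (ramificationSubgroup K S)).toTopRep (N.map (toUnramifiedQuot K S))
        (QuotientGroup.mk (QuotientGroup.mk σ : GaloisGroupUnramifiedOutside K S) :
          GaloisGroupUnramifiedOutside K S ⧸ N.map (toUnramifiedQuot K S))).hom
        (invariantsEquiv S ρ N hN hNS hρ w) :=
  mapsEquiv_rTransHom S ρ N hN hNS hρ σ (w : absoluteGaloisGroup K ⧸ N → M)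

/-- **`T ∘ Hⁿ(G_S, R_{σN}) = Hⁿ(R_{π(σ)N̄}) ∘ T`** on `Hⁿ(G_S, Maps(Γ_K ⧸ N, M)^{N_S})`, every degree (naturality of the
continuous-cohomology transport; `Hⁿ(G_S, R_{σN})` in the raw currency of the Poitou–Tate naturality clause (N)).
[cite: SerreLocalFields1979, VII §5] [cite: NeukirchSchmidtWingberg2008, I §6 Prop. (1.6.5)] -/
theorem restrictedCohomologyEquiv_map_rTransHom [N.FiniteIndex] (n : ℕ) (σ : absoluteGaloisGroup K)
    (c : restrictedCohomology (ρ.coindOpen N hN) S n) :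
    restrictedCohomologyEquiv S ρ N hN hNS hρ n
        ((ContinuousCohomology.map (ContinuousMonoidHom.id (GaloisGroupUnramifiedOutside K S))
          (ContinuousRep.invariantsHom (N := ramificationSubgroup K S)
            (ρ.coindOpenRTrans N hN (QuotientGroup.mk σ : absoluteGaloisGroup K ⧸ N))) n).hom c) =
      cohomologyMap (rTransHom (ρ.quotientInvariants (ramificationSubgroup K S)).toTopRep (N.map (toUnramifiedQuot K S))
        (QuotientGroup.mk (QuotientGroup.mk σ : GaloisGroupUnramifiedOutside K S) :
          GaloisGroupUnramifiedOutside K S ⧸ N.map (toUnramifiedQuot K S))) n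
        (restrictedCohomologyEquiv S ρ N hN hNS hρ n c) := by
  unfold restrictedCohomologyEquiv
  exact continuousCohomologyAddEquiv_map
    (X := ((ρ.coindOpen N hN).quotientInvariants (ramificationSubgroup K S)).toTopRep)
    (X' := coindFin.{0, 0} (ρ.quotientInvariants (ramificationSubgroup K S)).toTopRep (N.map (toUnramifiedQuot K S)))
    (Y := ((ρ.coindOpen N hN).quotientInvariants (ramificationSubgroup K S)).toTopRep)
    (Y' := coindFin.{0, 0} (ρ.quotientInvariants (ramificationSubgroup K S)).toTopRep (N.map (toUnramifiedQuot K S)))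
    (invariantsEquiv S ρ N hN hNS hρ) (invariantsEquiv_map S ρ N hN hNS hρ)
    (invariantsEquiv S ρ N hN hNS hρ) (invariantsEquiv_map S ρ N hN hNS hρ)
    (ContinuousMonoidHom.id (GaloisGroupUnramifiedOutside K S))
    (ContinuousRep.invariantsHom (N := ramificationSubgroup K S)
      (ρ.coindOpenRTrans N hN (QuotientGroup.mk σ : absoluteGaloisGroup K ⧸ N)))
    (resIdHom (rTransHom (ρ.quotientInvariants (ramificationSubgroup K S)).toTopRep (N.map (toUnramifiedQuot K S))
        (QuotientGroup.mk (QuotientGroup.mk σ : GaloisGroupUnramifiedOutside K S) :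
          GaloisGroupUnramifiedOutside K S ⧸ N.map (toUnramifiedQuot K S))))
    (fun w => invariantsEquiv_rTransHom S ρ N hN hNS hρ σ w) n c

section ShapiroConj

variable [N.FiniteIndex]

/-- **`sh_S (T (H¹(G_S, R_{σN}) c)) = (π σ) · sh_S (T c)`**: under the degree-one transport of
`ShaRestrictedShapiroLayer`, the action of `σ ∈ Γ_K` on `H¹(G_S, (Ind_N^{Γ_K} M)^{N_S})` through the right translation
`R_{σN}` becomes the conjugation action `layerConj (π σ)` on `H¹(N̄, M^{N_S})`.
[cite: NeukirchSchmidtWingberg2008, I §6 Prop. (1.6.5)] [cite: SerreLocalFields1979, VII §5] -/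
theorem layerShapiroEquiv_transport_rTransHom_one (σ : absoluteGaloisGroup K)
    (c : restrictedCohomology (ρ.coindOpen N hN) S 1) :
    layerShapiroEquiv S ρ N hN 1 (restrictedCohomologyEquiv S ρ N hN hNS hρ 1
        ((ContinuousCohomology.map (ContinuousMonoidHom.id (GaloisGroupUnramifiedOutside K S))
          (ContinuousRep.invariantsHom (N := ramificationSubgroup K S)
            (ρ.coindOpenRTrans N hN (QuotientGroup.mk σ : absoluteGaloisGroup K ⧸ N))) 1).hom c)) =
      layerConj S ρ N (toUnramifiedQuot K S σ) 1
        (layerShapiroEquiv S ρ N hN 1 (restrictedCohomologyEquiv S ρ N hN hNS hρ 1 c)) := by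
  rw [restrictedCohomologyEquiv_map_rTransHom]
  haveI : TotallyDisconnectedSpace (GaloisGroupUnramifiedOutside K S) :=
    Literature.GroupTheory.ProfiniteSubquotients.totallyDisconnectedSpace_quotient
      (ramificationSubgroup K S) (ramificationSubgroup_isClosed K S)
  exact ContinuousRep.shapiroCoindFinAddEquiv_rTransHom_one (ρ.quotientInvariants (ramificationSubgroup K S))
    (N.map (toUnramifiedQuot K S)) (isOpen_map_toUnramifiedQuot S N hN) (toUnramifiedQuot K S σ) _

/-- **`sh_S (T (H²(G_S, R_{σN}) c)) = (π σ) · sh_S (T c)`** (degree `2`). [cite: NeukirchSchmidtWingberg2008, I §6 Prop. (1.6.5)] [cite: SerreLocalFields1979, VII §5] -/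
theorem layerShapiroEquiv_transport_rTransHom_two (σ : absoluteGaloisGroup K)
    (c : restrictedCohomology (ρ.coindOpen N hN) S 2) :
    layerShapiroEquiv S ρ N hN 2 (restrictedCohomologyEquiv S ρ N hN hNS hρ 2
        ((ContinuousCohomology.map (ContinuousMonoidHom.id (GaloisGroupUnramifiedOutside K S))
          (ContinuousRep.invariantsHom (N := ramificationSubgroup K S)
            (ρ.coindOpenRTrans N hN (QuotientGroup.mk σ : absoluteGaloisGroup K ⧸ N))) 2).hom c)) =
      layerConj S ρ N (toUnramifiedQuot K S σ) 2
        (layerShapiroEquiv S ρ N hN 2 (restrictedCohomologyEquiv S ρ N hN hNS hρ 2 c)) := by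
  rw [restrictedCohomologyEquiv_map_rTransHom]
  haveI : TotallyDisconnectedSpace (GaloisGroupUnramifiedOutside K S) :=
    Literature.GroupTheory.ProfiniteSubquotients.totallyDisconnectedSpace_quotient
      (ramificationSubgroup K S) (ramificationSubgroup_isClosed K S)
  exact ContinuousRep.shapiroCoindFinAddEquiv_rTransHom_two (ρ.quotientInvariants (ramificationSubgroup K S))
    (N.map (toUnramifiedQuot K S)) (isOpen_map_toUnramifiedQuot S N hN) (toUnramifiedQuot K S σ) _

-- On `Шⁿ_S` itself: `Hⁿ(G_S, R_{σN})` preserves `shaRestricted` (`DiscreteGaloisModule.map_mem_shaRestricted`), and by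
-- `coe_shaRestrictedLayerEquiv_one/_two` the two theorems above ARE the `Δ`-equivariance of
-- `shaRestrictedLayerEquiv_one/_two` read on the ambient groups (the subtype restatement is left to the consumer:
-- elaborating it here exceeds the default heartbeat budget).

end ShapiroConj

end ShaLayer

end Literature.NumberTheory.GaloisCohomology

end
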